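import Summits.NavierStokesRegularity.NavierStokesRegularity.Theorems.TypeICertificateLadderTargetStrainCubeSharpInterpolation
import Summits.NavierStokesRegularity.NavierStokesRegularity.Theorems.TypeICertificateLadderTargetStrainCubeRung
import HarnessLib

/-!
# Crux `Target` = `TypeICertificateLadder.NoTypeIBlowup` (stmt-NavierStokesRegularity-1217), line
# `depletion-ladder`: THE SHARP DEPLETION CONSTANT `κ = (2+√3)/9` AND RUNGS UP TO `C = 2.41`

`--supports stmt-NavierStokesRegularity-1217` (sharpening of the landed `…StrainCubeDepletion.lean` /
`…StrainCubeRung.lean` by the operator-norm gain of `…StrainCubeOpNorm.lean`).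

* `abs_integral_stretching_le_strainCube_sharp` — for a `C^∞` divergence-free `v : ℝ³ → ℝ³` with
  `|v| ≤ M`, bounded gradient and `D⁰v, D¹v, D²v ∈ L²`:
  `|∫⟪ω, Dv ω⟫| ≤ ((2+√3)/9) · M · ‖ω‖₂ · ‖∇ω‖₂`, `(2+√3)/9 = 0.4147…`
  (`(2√6/9)(1/(2√2) + √(2/3)/2) = (√3+2)/9`).
* `hasSmoothExtensionPast_of_rate_lt_sharp` — rungs `X_C` for every `C` with `((2+√3)/9)·C < 1`,
  i.e. `C < 9/(2+√3) = 18 − 9√3 = 2.4115…`; `rung_of_le_sharp` — all `0 < C ≤ 2.41`.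

WHAT THIS IS NOT: not the crux (descent S3 open); the limit `C → ∞` is out of reach of any
depletion constant (`κ > 0`). [folklore]
-/

noncomputable section

open Set Filter Topology MeasureTheory
open scoped RealInnerProductSpace ENNReal NNReal Laplacian ContDiff
open Literature.Analysis.FluidPDE

namespace Summit.NavierStokesRegularity.NavierStokesRegularity.Theorems.DepletionLadder.StrainCube

-- the problem directory repeats the summit name (`NavierStokesRegularity/NavierStokesRegularity`)
set_option linter.dupNamespace false

open Summit.NavierStokesRegularity.NavierStokesRegularity.Theorems.RungReynoldsOne
open Summit.NavierStokesRegularity.NavierStokesRegularity.Theorems.DepletionLadder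

variable {v : EuclideanSpace ℝ (Fin 3) → EuclideanSpace ℝ (Fin 3)}

/-- The sharp constant bookkeeping:
`(2√6/9)(½ √W √(Z/2) + √(2/3) √(Z/2) √(W/2)) = ((2+√3)/9) √Z √W`. [folklore] -/
theorem depletion_constant_sharp_eq (Z W : ℝ) :
    (2 / 9) * Real.sqrt 6 * ((1 / 2) * Real.sqrt W * Real.sqrt ((1 / 2) * Z) +
        Real.sqrt (2 / 3) * Real.sqrt ((1 / 2) * Z) * Real.sqrt ((1 / 2) * W)) =
      (2 + Real.sqrt 3) / 9 * Real.sqrt Z * Real.sqrt W := by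
  have h12 : Real.sqrt (1 / 2) * Real.sqrt (1 / 2) = 1 / 2 := Real.mul_self_sqrt (by norm_num)
  have h63 : Real.sqrt 6 * Real.sqrt (1 / 2) = Real.sqrt 3 := by
    rw [← Real.sqrt_mul (by norm_num)]; norm_num
  have h64 : Real.sqrt 6 * Real.sqrt (2 / 3) = 2 := by
    rw [← Real.sqrt_mul (by norm_num), show (6 : ℝ) * (2 / 3) = 2 ^ 2 by norm_num,
      Real.sqrt_sq (by norm_num)]
  rw [Real.sqrt_mul (by norm_num : (0:ℝ) ≤ 1 / 2) Z, Real.sqrt_mul (by norm_num : (0:ℝ) ≤ 1 / 2) W]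
  linear_combination (1 / 9 * Real.sqrt Z * Real.sqrt W) * h63 +
    (2 / 9 * Real.sqrt Z * Real.sqrt W * Real.sqrt 6 * Real.sqrt (2 / 3)) * h12 +
    (1 / 9 * Real.sqrt Z * Real.sqrt W) * h64

/-- **THE SHARP DEPLETION CONSTANT `(2+√3)/9`.** For a `C^∞` divergence-free field `v : ℝ³ → ℝ³`
with `|v| ≤ M`, `‖Dv‖ ≤ B` and `D⁰v, D¹v, D²v ∈ L²`:
`|∫⟪curl v, Dv (curl v)⟫| ≤ ((2+√3)/9) · M · √(∫‖curl v‖²) · √(∫|∇ curl v|²_F)`. [folklore] -/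
theorem abs_integral_stretching_le_strainCube_sharp (hv : ContDiff ℝ ∞ v)
    (hdiv : VectorCalculus.IsDivFree v)
    {M B : ℝ} (hM : ∀ x, ‖v x‖ ≤ M) (hB : ∀ x, ‖fderiv ℝ v x‖ ≤ B)
    (h0 : ∫⁻ x, ‖iteratedFDeriv ℝ 0 v x‖ₑ ^ 2 < ⊤) (h1 : ∫⁻ x, ‖iteratedFDeriv ℝ 1 v x‖ₑ ^ 2 < ⊤)
    (h2 : ∫⁻ x, ‖iteratedFDeriv ℝ 2 v x‖ₑ ^ 2 < ⊤) :
    |∫ x, ⟪curl v x, fderiv ℝ v x (curl v x)⟫| ≤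
      (2 + Real.sqrt 3) / 9 * M * Real.sqrt (∫ x, ‖curl v x‖ ^ 2) *
        Real.sqrt (∫ x, frobeniusNormSq (fderiv ℝ (curl v) x)) := by
  set s : Fin 3 → Fin 3 → EuclideanSpace ℝ (Fin 3) → ℝ :=
    fun i j y => (pderiv j (fun z => v z i) y + pderiv i (fun z => v z j) y) / 2 with hsdef
  have hs : ∀ i j y, s i j y = (pderiv j (fun z => v z i) y + pderiv i (fun z => v z j) y) / 2 :=
    fun i j y => rfl
  have hM0 : 0 ≤ M := (norm_nonneg _).trans (hM 0)
  set Z := ∫ x, ‖curl v x‖ ^ 2 with hZ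
  set W := ∫ x, frobeniusNormSq (fderiv ℝ (curl v) x) with hW
  have hA := abs_integral_stretching_le_integral_cube hv hdiv hM hB h1 hs
  have hI := integral_strainCube_le_sharp hv hdiv hM hB h1 h2 hs
  have e1 : ∫ x, ∑ i, ∑ j, s i j x ^ 2 = (1 / 2) * Z := integral_sumSq_sym_eq_half hv hdiv h0 h1 hs
  have e2 : ∫ x, ∑ l, ∑ i, ∑ j, pderiv l (s i j) x ^ 2 = (1 / 2) * W :=
    integral_gradSq_sym_eq_half hv hdiv h1 h2 hs
  have e3 : ∫ x, ‖(Δ v) x‖ ^ 2 = W := integral_norm_laplacian_sq_eq hv hdiv h1 h2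
  rw [e1, e2, e3] at hI
  have hc : 0 ≤ (2 / 9) * Real.sqrt 6 := by positivity
  calc |∫ x, ⟪curl v x, fderiv ℝ v x (curl v x)⟫|
      ≤ (2 / 9) * Real.sqrt 6 * ∫ x, (∑ i, ∑ j, s i j x ^ 2) * Real.sqrt (∑ i, ∑ j, s i j x ^ 2) := hA
    _ ≤ (2 / 9) * Real.sqrt 6 * (M * ((1 / 2) * Real.sqrt W * Real.sqrt ((1 / 2) * Z) +
          Real.sqrt (2 / 3) * Real.sqrt ((1 / 2) * Z) * Real.sqrt ((1 / 2) * W))) :=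
        mul_le_mul_of_nonneg_left hI hc
    _ = (2 + Real.sqrt 3) / 9 * M * Real.sqrt Z * Real.sqrt W := by
        rw [show (2 / 9) * Real.sqrt 6 * (M * ((1 / 2) * Real.sqrt W * Real.sqrt ((1 / 2) * Z) +
            Real.sqrt (2 / 3) * Real.sqrt ((1 / 2) * Z) * Real.sqrt ((1 / 2) * W))) =
            M * ((2 / 9) * Real.sqrt 6 * ((1 / 2) * Real.sqrt W * Real.sqrt ((1 / 2) * Z) +
            Real.sqrt (2 / 3) * Real.sqrt ((1 / 2) * Z) * Real.sqrt ((1 / 2) * W))) by ring,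
          depletion_constant_sharp_eq Z W]
        ring

/-- **Rungs below `18 − 9√3 ≈ 2.4115`.** A classical solution of the unforced Navier–Stokes system on
`ℝ³ × [0,T)` (`ν, T > 0`), Leray–Hopf from its rapidly decaying datum, with eventual dimensionless
rate `√(T−t)‖u(t,x)‖ ≤ C√ν` and `((2+√3)/9)·C < 1`, extends smoothly past `T`. [folklore] -/
theorem hasSmoothExtensionPast_of_rate_lt_sharp {ν T C : ℝ} (hν : 0 < ν) (hT : 0 < T) (hC : 0 < C)
    (hκC : (2 + Real.sqrt 3) / 9 * C < 1)
    {u : ℝ → EuclideanSpace ℝ (Fin 3) → EuclideanSpace ℝ (Fin 3)}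
    {p : ℝ → EuclideanSpace ℝ (Fin 3) → ℝ}
    (hsol : IsClassicalNSSolutionOn (Ico 0 T) ν 0 u p) (hLH : IsLerayHopfOn T ν 0 (u 0) u)
    (hdec : HasRapidSpatialDecay (u 0))
    (hrate : ∀ᶠ t in 𝓝[<] T, ∀ x, Real.sqrt (T - t) * ‖u t x‖ ≤ C * Real.sqrt ν) :
    HasSmoothExtensionPast ν 0 u T := by
  have hκ0 : 0 ≤ (2 + Real.sqrt 3) / 9 := by positivity
  refine rung_of_flowwiseDepletion hν hT hκ0 hC hκC hsol hLH hdec (fun t ht M hM => ?_) hrate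
  have ht' : (t + T) / 2 ∈ Ioo 0 T := ⟨by linarith [ht.1], by linarith [ht.2]⟩
  obtain ⟨q, hsolt, hut, -, -⟩ := stub_taoCover hν hT hsol hLH hdec ht'
  have htI : t ∈ Icc 0 ((t + T) / 2) := ⟨ht.1, by linarith [ht.2]⟩
  obtain ⟨C₀, hC₀⟩ := hut 0
  obtain ⟨C₁, hC₁⟩ := hut 1
  obtain ⟨C₂, hC₂⟩ := hut 2
  obtain ⟨B₁, -, hB₁⟩ := exists_forall_norm_fderiv_le_of_hasBoundedSobolevNormsOn
    (fun s hs => (hsolt.contDiff_velocity hs).of_le (by norm_cast)) hut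
  have h0 : ∫⁻ x, ‖iteratedFDeriv ℝ 0 (u t) x‖ₑ ^ 2 < ⊤ := (hC₀ t htI).trans_lt ENNReal.coe_lt_top
  have h1 : ∫⁻ x, ‖iteratedFDeriv ℝ 1 (u t) x‖ₑ ^ 2 < ⊤ := (hC₁ t htI).trans_lt ENNReal.coe_lt_top
  have h2 : ∫⁻ x, ‖iteratedFDeriv ℝ 2 (u t) x‖ₑ ^ 2 < ⊤ := (hC₂ t htI).trans_lt ENNReal.coe_lt_top
  have hv : ContDiff ℝ ∞ (u t) := hsol.contDiff_velocity ht
  have hdiv : VectorCalculus.IsDivFree (u t) := hsol.divFree t ht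
  exact abs_integral_stretching_le_strainCube_sharp hv hdiv hM (hB₁ t htI) h0 h1 h2

/-- **All rungs up to `2.41`**: for every `0 < C ≤ 2.41` the rung `X_C` holds
(`(2+√3)/9 · 2.41 < 1` since `√3 < 1.7321`). [folklore] -/
theorem rung_of_le_sharp {C : ℝ} (hC : 0 < C) (hC' : C ≤ 2.41) :
    ∀ (ν T : ℝ), 0 < ν → 0 < T →
      ∀ (u : ℝ → EuclideanSpace ℝ (Fin 3) → EuclideanSpace ℝ (Fin 3))
        (p : ℝ → EuclideanSpace ℝ (Fin 3) → ℝ),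
        IsClassicalNSSolutionOn (Set.Ico 0 T) ν 0 u p → IsLerayHopfOn T ν 0 (u 0) u →
        HasRapidSpatialDecay (u 0) →
        (∀ᶠ t in 𝓝[<] T, ∀ x, Real.sqrt (T - t) * ‖u t x‖ ≤ C * Real.sqrt ν) →
        HasSmoothExtensionPast ν 0 u T := by
  intro ν T hν hT u p hsol hLH hdec hrate
  have h3 : Real.sqrt 3 < 1.7321 := by
    rw [Real.sqrt_lt' (by norm_num)]; norm_num
  have hκC : (2 + Real.sqrt 3) / 9 * C < 1 := by
    have h0 : 0 ≤ Real.sqrt 3 := Real.sqrt_nonneg _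
    nlinarith
  exact hasSmoothExtensionPast_of_rate_lt_sharp hν hT hC hκC hsol hLH hdec hrate

end Summit.NavierStokesRegularity.NavierStokesRegularity.Theorems.DepletionLadder.StrainCube

end
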